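import Literature.Probability.LatticeModels.LatticeLaplacianZd
import Literature.Probability.LatticeModels.LatticeGreenAsymptotics
import Summits.CriticalPhenomena.Ising3DConformalLimit.Theorems.InverseSquareTelemetryEtaBoundsFromTelemetryBarriers
import Summits.CriticalPhenomena.Ising3DConformalLimit.Theorems.InverseSquareTelemetryPositiveSolutionAsymptoticsGreenModulation
import Summits.CriticalPhenomena.Ising3DConformalLimit.Theorems.InverseSquareTelemetryPositiveSolutionAsymptoticsSubProfile
import HarnessLib

/-!
# Crux `PositiveSolutionAsymptotics` (stmt-CriticalPhenomena-4496), stub H3₊: the super-profile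

THEOREM-ONLY file (no definitions, no named facts), `--supports stmt-CriticalPhenomena-4496`.
`stub_superProfile` is stub H3₊ of the registered skeleton of crux
`…Theses.InverseSquareTelemetry.PositiveSolutionAsymptotics`, the mirror image of the sub-profile
`stub_subProfile` (file `…PositiveSolutionAsymptoticsSubProfile.lean`, whose lattice identities and
a priori bounds are reused here). Data: an abstract Green-like `G : ℤ³ → ℝ`, positive, `ΔG = 0` off
the origin, `ΔG(0) = -1`, `|G(x) - a₀/|x|| ≤ K/|x|³`, and the modulation bounds of stub H2,
`a₀/|z| ≤ Φ_G(z) ≤ 3a₀/|z|` for `|z| ≥ r₃`, where `|z| = √(Σᵢ zᵢ²)` and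
`Φ_G(z) := 6 G(z) + 2 Σᵢ zᵢ (G(z+eᵢ) - G(z-eᵢ))`. Profile: with the finite bad set
`F₀ = {w ≠ 0, |w| < r₃}`, `B = max (G 0) (a₀ + K) ≥ G`, `λ = 2 r₃ B + (2B + 1)`,

  `Γ(y) = G(y) · (2 - |y|²/(4R²)) + (λ/R²) Σ_{w ∈ F₀} G(y - w)`.

By the discrete product rule and `Δ Σ_w G(· - w) = -𝟙_{F₀}`,
`ΔΓ(z) = (2 - |z|²/(4R²) - 1/(4R²)) ΔG(z) - Φ_G(z)/(4R²) - (λ/R²) 𝟙_{F₀}(z)`; this is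
`≤ -a₀/(4R²|z|)` on `r₃ ≤ |z| ≤ 3R`, `≤ (3r₃B/2 - λ)/R²` on `F₀`, `≤ -2 + 1/(4R²)` at `0`, which
absorbs `|V| |Γ|` (resp. `|V(0)| |Γ(0)| + 1` at the pole) for `|V| ≤ c₁/R²`, `R ≥ R₀`; moreover
`Γ ≥ 0` on `|z| ≤ 2R` (there `2 - |z|²/(4R²) ≥ 1`) and `Γ ≤ (9/4) a₀/|z|` on `R/8 ≤ |z| ≤ 3R`
(there `K/|z|³, (λ/R²)ΣG ≤ a₀/(16|z|)`). Order: the Laplacian of the profile, real arithmetic, the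
stub. -/

noncomputable section

namespace Summit.CriticalPhenomena.Ising3DConformalLimit.Theorems.PositiveSolutionAsymptotics

open Literature.Probability.LatticeModels Finset

/-! ### The Laplacian of the super-profile -/

/-- **Laplacian of the profile** `Γ(y) = G(y) (β + γ|y|²) + μ Σ_{w ∈ s} G(y - w)` when `ΔG = 0` off
the origin and `ΔG(0) = -1`: `ΔΓ(z) = (β + γ|z|² + γ) ΔG(z) + γ Φ_G(z) - μ 𝟙_s(z)`. [folklore] -/
theorem superProfile_laplacian_profile {G : Site 3 → ℝ}
    (hG0 : ∀ x : Site 3, x ≠ 0 → latticeLaplacianZd G x = 0) (hG1 : latticeLaplacianZd G 0 = -1)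
    (s : Finset (Site 3)) (β γ μ : ℝ) (z : Site 3) :
    latticeLaplacianZd (fun y => G y * (β + γ * ∑ j, ((y j : ℤ) : ℝ) ^ 2) +
        μ * ∑ w ∈ s, G (y - w)) z =
      (β + γ * ∑ j, ((z j : ℤ) : ℝ) ^ 2 + γ) * latticeLaplacianZd G z +
        γ * (6 * G z + 2 * ∑ i : Fin 3, ((z i : ℤ) : ℝ) *
          (G (z + Pi.single i 1) - G (z - Pi.single i 1))) -
        μ * (if z ∈ s then 1 else 0) := by
  rw [(EtaBoundsFromTelemetry.latticeLaplacianZd_sub_const_mul _ _ μ z).2,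
    subProfile_laplacian_mul_quad, subProfile_laplacian_potential hG0 hG1]
  split_ifs <;> ring

/-! ### The real arithmetic of the super-profile -/

/-- **Far sites** (`r = |z| ∈ [1, 3R]`, `R ≥ 1`): if `0 ≤ g ≤ a₀/r + K/r³`, `0 ≤ X ≤ 1/r`,
`|V| ≤ c₁/R²`, `c₁ (2(a₀+K) + 1) ≤ a₀/4` and `Φ ≥ a₀/r`, then with `ψ = 2 - r²/(4R²) ∈ [-2, 2]`:
`-Φ/(4R²) ≤ V (g ψ + X)` (as `|g ψ + X| ≤ (2(a₀+K) + 1)/r`). [folklore] -/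
theorem superProfile_arith_far {a₀ K R r g X V Φ c₁ : ℝ} (ha : 0 < a₀) (hK : 0 ≤ K)
    (hr1 : 1 ≤ r) (hrR : r ≤ 3 * R) (hR : 1 ≤ R) (hg0 : 0 ≤ g) (hg : g ≤ a₀ / r + K / r ^ 3)
    (hX0 : 0 ≤ X) (hX : X ≤ 1 / r) (hV : |V| ≤ c₁ / R ^ 2)
    (hc₁ : c₁ * (2 * (a₀ + K) + 1) ≤ a₀ / 4) (hΦ : a₀ / r ≤ Φ) :
    -(1 / (4 * R ^ 2)) * Φ ≤ V * (g * (2 + -(1 / (4 * R ^ 2)) * r ^ 2) + X) := by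
  have hr0 : 0 < r := by linarith
  have hR0 : 0 < R := by linarith
  have hK3 : K / r ^ 3 ≤ K / r :=
    div_le_div_of_nonneg_left hK hr0 (le_self_pow₀ hr1 three_ne_zero)
  have hg' : g ≤ (a₀ + K) / r := by rw [add_div]; linarith
  have hψ2 : 2 + -(1 / (4 * R ^ 2)) * r ^ 2 ≤ 2 := by
    have : 0 ≤ 1 / (4 * R ^ 2) * r ^ 2 := by positivity
    linarith
  have hψ2' : -2 ≤ 2 + -(1 / (4 * R ^ 2)) * r ^ 2 := by
    have hrr : r * r ≤ 3 * R * (3 * R) := mul_le_mul hrR hrR hr0.le (by linarith)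
    have h : r ^ 2 / (4 * R ^ 2) ≤ 4 := by
      rw [div_le_iff₀ (by positivity)]; nlinarith
    have e : 1 / (4 * R ^ 2) * r ^ 2 = r ^ 2 / (4 * R ^ 2) := by ring
    linarith
  have habs : |-(g * (2 + -(1 / (4 * R ^ 2)) * r ^ 2) + X)| ≤ (2 * (a₀ + K) + 1) / r := by
    rw [abs_neg]
    have h1 : |g * (2 + -(1 / (4 * R ^ 2)) * r ^ 2)| ≤ (a₀ + K) / r * 2 := by
      rw [abs_mul, abs_of_nonneg hg0]
      exact mul_le_mul hg' (abs_le.2 ⟨hψ2', hψ2⟩) (abs_nonneg _) (by positivity)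
    have e : (2 * (a₀ + K) + 1) / r = (a₀ + K) / r * 2 + 1 / r := by ring
    rw [e]
    refine (abs_add_le _ _).trans ?_
    rw [abs_of_nonneg hX0]
    linarith
  have h1 := subProfile_mul_le hV habs
  rw [mul_neg] at h1
  have h2 : c₁ / R ^ 2 * ((2 * (a₀ + K) + 1) / r) ≤ 1 / (4 * R ^ 2) * Φ :=
    calc c₁ / R ^ 2 * ((2 * (a₀ + K) + 1) / r)
          = c₁ * (2 * (a₀ + K) + 1) / (R ^ 2 * r) := div_mul_div_comm _ _ _ _
      _ ≤ (a₀ / 4) / (R ^ 2 * r) := div_le_div_of_nonneg_right hc₁ (by positivity)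
      _ = 1 / (4 * R ^ 2) * (a₀ / r) := by field_simp
      _ ≤ 1 / (4 * R ^ 2) * Φ := mul_le_mul_of_nonneg_left hΦ (by positivity)
  linarith

/-- **Near sites** (`0 ≤ r ≤ 3R`, `R ≥ 1`): if `0 ≤ g ≤ B`, `0 ≤ X ≤ 1`, `|V| ≤ c₁/R²`, `c₁ ≤ 1` and
`Φ ≥ -6 r₃ B`, then `-Φ/(4R²) - λ/R² ≤ V (g ψ + X)` for `λ = 2 r₃ B + (2B + 1)`,
`ψ = 2 - r²/(4R²)` (as `|g ψ + X| ≤ 2B + 1`). [folklore] -/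
theorem superProfile_arith_near {B r₃ R r g X V Φ c₁ : ℝ} (hB : 0 ≤ B)
    (hr₃ : 0 ≤ r₃) (hr0 : 0 ≤ r) (hrR : r ≤ 3 * R) (hR : 1 ≤ R)
    (hg0 : 0 ≤ g) (hg : g ≤ B) (hX0 : 0 ≤ X) (hX : X ≤ 1)
    (hV : |V| ≤ c₁ / R ^ 2) (hc₁ : c₁ ≤ 1) (hΦ : -(6 * r₃ * B) ≤ Φ) :
    -(1 / (4 * R ^ 2)) * Φ - (2 * r₃ * B + (2 * B + 1)) / R ^ 2 ≤
      V * (g * (2 + -(1 / (4 * R ^ 2)) * r ^ 2) + X) := by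
  have hR0 : 0 < R := by linarith
  have hψ2 : 2 + -(1 / (4 * R ^ 2)) * r ^ 2 ≤ 2 := by
    have : 0 ≤ 1 / (4 * R ^ 2) * r ^ 2 := by positivity
    linarith
  have hψ2' : -2 ≤ 2 + -(1 / (4 * R ^ 2)) * r ^ 2 := by
    have hrr : r * r ≤ 3 * R * (3 * R) := mul_le_mul hrR hrR hr0 (by linarith)
    have h : r ^ 2 / (4 * R ^ 2) ≤ 4 := by
      rw [div_le_iff₀ (by positivity)]; nlinarith
    have e : 1 / (4 * R ^ 2) * r ^ 2 = r ^ 2 / (4 * R ^ 2) := by ring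
    linarith
  have habs : |-(g * (2 + -(1 / (4 * R ^ 2)) * r ^ 2) + X)| ≤ 2 * B + 1 := by
    rw [abs_neg]
    have h1 : |g * (2 + -(1 / (4 * R ^ 2)) * r ^ 2)| ≤ B * 2 := by
      rw [abs_mul, abs_of_nonneg hg0]
      exact mul_le_mul hg (abs_le.2 ⟨hψ2', hψ2⟩) (abs_nonneg _) hB
    refine (abs_add_le _ _).trans ?_
    rw [abs_of_nonneg hX0]
    linarith
  have h1 := subProfile_mul_le hV habs
  rw [mul_neg] at h1
  have h2 : c₁ / R ^ 2 * (2 * B + 1) ≤ (2 * B + 1) / R ^ 2 := by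
    rw [div_mul_eq_mul_div]
    exact div_le_div_of_nonneg_right (by nlinarith) (by positivity)
  have h3 : -(1 / (4 * R ^ 2)) * Φ ≤ 1 / (4 * R ^ 2) * (6 * r₃ * B) := by
    have := mul_le_mul_of_nonneg_left hΦ (by positivity : (0 : ℝ) ≤ 1 / (4 * R ^ 2))
    linarith
  have h4 : 1 / (4 * R ^ 2) * (6 * r₃ * B) - (2 * r₃ * B + (2 * B + 1)) / R ^ 2
      = -((2 * B + 1) / R ^ 2) - (r₃ * B / 2) / R ^ 2 := by
    field_simp
    ring
  have h5 : 0 ≤ (r₃ * B / 2) / R ^ 2 := by positivity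
  linarith

/-- **The origin** (`R ≥ 1`): if `0 ≤ g ≤ B`, `0 ≤ X ≤ 1`, `|V| ≤ c₁/R²` and `c₁ (2B + 1) ≤ 1/2`, then
`-(2 - 1/(4R²)) - 6g/(4R²) ≤ V (2g + X) - 1` (left side `≤ -7/4`, right side `≥ -3/2`).
[folklore] -/
theorem superProfile_arith_origin {B R g X V c₁ : ℝ} (hR : 1 ≤ R)
    (hg0 : 0 ≤ g) (hg : g ≤ B) (hX0 : 0 ≤ X) (hX : X ≤ 1)
    (hV : |V| ≤ c₁ / R ^ 2) (hc₁ : c₁ * (2 * B + 1) ≤ 1 / 2) :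
    -(2 + -(1 / (4 * R ^ 2))) + -(1 / (4 * R ^ 2)) * (6 * g) ≤ V * (g * 2 + X) - 1 := by
  have hR0 : 0 < R := by linarith
  have habs : |-(g * 2 + X)| ≤ 2 * B + 1 := by
    rw [abs_neg, abs_le]; constructor <;> linarith
  have h1 := subProfile_mul_le hV habs
  rw [mul_neg] at h1
  have h2 : c₁ / R ^ 2 * (2 * B + 1) ≤ 1 / 2 := by
    rw [div_mul_eq_mul_div, div_le_iff₀ (by positivity)]; nlinarith
  have h3 : 1 / (4 * R ^ 2) ≤ 1 / 4 :=
    div_le_div_of_nonneg_left zero_le_one (by norm_num) (by nlinarith)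
  have h4 : 0 ≤ 1 / (4 * R ^ 2) * (6 * g) := by positivity
  linarith

/-- **Nonnegativity** (`0 ≤ r ≤ 2R`): `g (2 - r²/(4R²)) + X ≥ 0` for `g, X ≥ 0`
(there `2 - r²/(4R²) ≥ 1`). [folklore] -/
theorem superProfile_arith_nonneg {R r g X : ℝ} (hR : 0 < R) (hr0 : 0 ≤ r) (hr : r ≤ 2 * R)
    (hg0 : 0 ≤ g) (hX0 : 0 ≤ X) :
    0 ≤ g * (2 + -(1 / (4 * R ^ 2)) * r ^ 2) + X := by
  have hψ : 1 ≤ 2 + -(1 / (4 * R ^ 2)) * r ^ 2 := by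
    have hrr : r * r ≤ 2 * R * (2 * R) := mul_le_mul hr hr hr0 (by linarith)
    have h : r ^ 2 / (4 * R ^ 2) ≤ 1 := by
      rw [div_le_one (by positivity)]; nlinarith
    have e : 1 / (4 * R ^ 2) * r ^ 2 = r ^ 2 / (4 * R ^ 2) := by ring
    linarith
  have := mul_nonneg hg0 (by linarith : (0 : ℝ) ≤ 2 + -(1 / (4 * R ^ 2)) * r ^ 2)
  linarith

/-- **Upper size bound** (`R/8 ≤ r ≤ 3R`, `R ≥ 1`): if `|g - a₀/r| ≤ K/r³`, `1024 K ≤ a₀ R`,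
`0 ≤ X`, `X R² ≤ P` and `48 P ≤ a₀ R`, then `g (2 - r²/(4R²)) + X ≤ (9/4) a₀/r`
(both `K/r³` and `X` are `≤ a₀/(16 r)`). [folklore] -/
theorem superProfile_arith_size {a₀ K R P r g X : ℝ} (ha : 0 < a₀) (hR1 : 1 ≤ R)
    (hz1 : R / 8 ≤ r) (hz3 : r ≤ 3 * R) (hg : |g - a₀ / r| ≤ K / r ^ 3)
    (hRK : 1024 * K ≤ a₀ * R) (hX0 : 0 ≤ X) (hXR : X * R ^ 2 ≤ P) (hRP : 48 * P ≤ a₀ * R) :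
    g * (2 + -(1 / (4 * R ^ 2)) * r ^ 2) + X ≤ 9 / 4 * (a₀ / r) := by
  have hR0 : 0 < R := by linarith
  have hr0 : 0 < r := (div_pos hR0 (by norm_num)).trans_le hz1
  have hKr : 16 * K ≤ a₀ * r ^ 2 := by
    have h1 : R ^ 2 ≤ 64 * r ^ 2 := by nlinarith
    have h2 : 1024 * K ≤ a₀ * R ^ 2 :=
      hRK.trans (mul_le_mul_of_nonneg_left (le_self_pow₀ hR1 two_ne_zero) ha.le)
    nlinarith [mul_le_mul_of_nonneg_left h1 ha.le]
  have hXr : 16 * X * r ≤ a₀ := by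
    have h3 : 16 * X * r ≤ 48 * X * R := by nlinarith [mul_le_mul_of_nonneg_left hz3 hX0]
    have h4 : 48 * X * R * R ≤ a₀ * R := by nlinarith
    linarith [le_of_mul_le_mul_right h4 hR0]
  obtain ⟨hg1, hg2⟩ := abs_le.1 hg
  have har : 0 < a₀ / r := div_pos ha hr0
  have hK3 : K / r ^ 3 ≤ (a₀ / r) / 16 := by
    rw [div_div, div_le_div_iff₀ (by positivity) (by positivity)]; nlinarith
  have hX' : X ≤ (a₀ / r) / 16 := by
    rw [div_div, le_div_iff₀ (by positivity)]; linarith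
  have hg0 : 0 ≤ g := by linarith
  have hψ : g * (2 + -(1 / (4 * R ^ 2)) * r ^ 2) ≤ g * 2 := by
    have h0 : 0 ≤ 1 / (4 * R ^ 2) * r ^ 2 := by positivity
    nlinarith [mul_nonneg hg0 h0]
  linarith

/-! ### The stub -/

/-- **H3₊ (the super-profile).** Let `G : ℤ³ → ℝ` be positive, harmonic off the origin with
`ΔG(0) = -1`, with `|G(x) - a₀/|x|| ≤ K/|x|³` and the modulation bounds of H2 beyond `r₃`. Then
there are `R₀` and `c₁ > 0` such that for every `R ≥ R₀` the profile
`Γ = G·(2 - |·|²/(4R²)) + (λ/R²) Σ_{0<|w|<r₃} G(· - w)` (`λ = 2r₃B + 2B + 1`,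
`B = max (G 0) (a₀ + K)`) satisfies, for every potential `V` with `|V| ≤ c₁/R²` on `{|z| ≤ 3R}`:
`ΔΓ ≤ V Γ` on `{0 < |z| ≤ 3R}`, `ΔΓ(0) ≤ V(0) Γ(0) - 1`; moreover `Γ ≥ 0` on `{|z| ≤ 2R}` and
`Γ(z) ≤ (9/4) a₀/|z|` on `R/8 ≤ |z| ≤ 3R`. Constants: `R₀ = r₃ + 3P + 48P/a₀ + 1024K/a₀`
(`P = λ · #F₀ · B`), `c₁ = min (1/(2(2B+1))) (a₀/(4(2(a₀+K)+1)))`. [folklore] -/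
theorem stub_superProfile :
    ∀ (G : Literature.Probability.LatticeModels.Site 3 → ℝ) (a₀ K r₃ : ℝ), 0 < a₀ → 0 ≤ K → 1 ≤ r₃ →
      (∀ x : Literature.Probability.LatticeModels.Site 3, x ≠ 0 → Literature.Probability.LatticeModels.latticeLaplacianZd G x = 0) →
      Literature.Probability.LatticeModels.latticeLaplacianZd G 0 = -1 →
      (∀ x : Literature.Probability.LatticeModels.Site 3, 0 < G x) →
      (∀ x : Literature.Probability.LatticeModels.Site 3, x ≠ 0 → |G x - a₀ / Real.sqrt (∑ i, ((x i : ℤ) : ℝ) ^ 2)| ≤ K / Real.sqrt (∑ i, ((x i : ℤ) : ℝ) ^ 2) ^ 3) →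
      (∀ z : Literature.Probability.LatticeModels.Site 3, r₃ ≤ Real.sqrt (∑ i, ((z i : ℤ) : ℝ) ^ 2) →
        a₀ / Real.sqrt (∑ i, ((z i : ℤ) : ℝ) ^ 2) ≤ 6 * G z + 2 * ∑ i : Fin 3, ((z i : ℤ) : ℝ) * (G (z + Pi.single i 1) - G (z - Pi.single i 1)) ∧
        6 * G z + 2 * ∑ i : Fin 3, ((z i : ℤ) : ℝ) * (G (z + Pi.single i 1) - G (z - Pi.single i 1)) ≤ 3 * a₀ / Real.sqrt (∑ i, ((z i : ℤ) : ℝ) ^ 2)) →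
      ∃ (R₀ c₁ : ℝ), 0 < c₁ ∧ ∀ R : ℝ, R₀ ≤ R → ∃ Γ : Literature.Probability.LatticeModels.Site 3 → ℝ,
        (∀ V : Literature.Probability.LatticeModels.Site 3 → ℝ,
          (∀ z : Literature.Probability.LatticeModels.Site 3, Real.sqrt (∑ i, ((z i : ℤ) : ℝ) ^ 2) ≤ 3 * R → |V z| ≤ c₁ / R ^ 2) →
          (∀ z : Literature.Probability.LatticeModels.Site 3, z ≠ 0 → Real.sqrt (∑ i, ((z i : ℤ) : ℝ) ^ 2) ≤ 3 * R →
              Literature.Probability.LatticeModels.latticeLaplacianZd Γ z ≤ V z * Γ z) ∧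
            Literature.Probability.LatticeModels.latticeLaplacianZd Γ 0 ≤ V 0 * Γ 0 - 1) ∧
        (∀ z : Literature.Probability.LatticeModels.Site 3, Real.sqrt (∑ i, ((z i : ℤ) : ℝ) ^ 2) ≤ 2 * R → 0 ≤ Γ z) ∧
        (∀ z : Literature.Probability.LatticeModels.Site 3, R / 8 ≤ Real.sqrt (∑ i, ((z i : ℤ) : ℝ) ^ 2) → Real.sqrt (∑ i, ((z i : ℤ) : ℝ) ^ 2) ≤ 3 * R →
          Γ z ≤ 9 / 4 * (a₀ / Real.sqrt (∑ i, ((z i : ℤ) : ℝ) ^ 2))) := by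
  intro G a₀ K r₃ ha hK hr₃ hG0 hG1 hGpos hGasym hmod
  -- the finite bad set `F₀ = {w ≠ 0, |w| < r₃}` as a finset `S`
  obtain ⟨S, hS⟩ : ∃ S : Finset (Site 3), ∀ w : Site 3, w ∈ S ↔
      w ≠ 0 ∧ Real.sqrt (∑ i, ((w i : ℤ) : ℝ) ^ 2) < r₃ := by
    have hfin : {w : Site 3 | w ≠ 0 ∧ Real.sqrt (∑ i, ((w i : ℤ) : ℝ) ^ 2) < r₃}.Finite := by
      refine (EtaBoundsFromTelemetry.finite_sumSq_le (r₃ ^ 2)).subset ?_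
      rintro w ⟨-, hw⟩
      exact ((Real.sqrt_lt' (by linarith)).1 hw).le
    exact ⟨hfin.toFinset, fun w => by rw [Set.Finite.mem_toFinset, Set.mem_setOf_eq]⟩
  -- constants
  have hGle : ∀ x, G x ≤ max (G 0) (a₀ + K) := subProfile_G_le ha hK hGasym
  set B : ℝ := max (G 0) (a₀ + K)
  have hB0 : 0 ≤ B := (hGpos 0).le.trans (hGle 0)
  set lam : ℝ := 2 * r₃ * B + (2 * B + 1)
  have hlam0 : 0 ≤ lam := by positivity
  set P : ℝ := lam * (S.card * B)
  have hP0 : 0 ≤ P := by positivity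
  set M₁ : ℝ := 2 * (a₀ + K) + 1
  set M₂ : ℝ := 2 * B + 1
  have hM₁0 : 0 < M₁ := by positivity
  have hM₂1 : 1 ≤ M₂ := by linarith
  refine ⟨r₃ + 3 * P + 48 * P / a₀ + 1024 * K / a₀, min (1 / (2 * M₂)) (a₀ / (4 * M₁)),
    lt_min (by positivity) (by positivity), fun R hR => ?_⟩
  have h48 : 0 ≤ 48 * P / a₀ := by positivity
  have h1024 : 0 ≤ 1024 * K / a₀ := by positivity
  have hR1 : 1 ≤ R := by linarith
  have hR0 : 0 < R := by linarith
  have hRP : 3 * P ≤ R := by linarith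
  have hRP' : 48 * P ≤ a₀ * R :=
    ((div_le_iff₀ ha).1 (by linarith : 48 * P / a₀ ≤ R)).trans_eq (mul_comm _ _)
  have hRK : 1024 * K ≤ a₀ * R :=
    ((div_le_iff₀ ha).1 (by linarith : 1024 * K / a₀ ≤ R)).trans_eq (mul_comm _ _)
  have hc₁ : min (1 / (2 * M₂)) (a₀ / (4 * M₁)) ≤ 1 :=
    (min_le_left _ _).trans (by rw [div_le_one (by positivity)]; linarith)
  have hcM₁ : min (1 / (2 * M₂)) (a₀ / (4 * M₁)) * M₁ ≤ a₀ / 4 :=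
    calc min (1 / (2 * M₂)) (a₀ / (4 * M₁)) * M₁ ≤ a₀ / (4 * M₁) * M₁ :=
          mul_le_mul_of_nonneg_right (min_le_right _ _) hM₁0.le
      _ = a₀ / 4 := by field_simp
  have hcM₂ : min (1 / (2 * M₂)) (a₀ / (4 * M₁)) * M₂ ≤ 1 / 2 :=
    calc min (1 / (2 * M₂)) (a₀ / (4 * M₁)) * M₂ ≤ 1 / (2 * M₂) * M₂ :=
          mul_le_mul_of_nonneg_right (min_le_left _ _) (by positivity)
      _ = 1 / 2 := by field_simp
  generalize min (1 / (2 * M₂)) (a₀ / (4 * M₁)) = c₁ at hc₁ hcM₁ hcM₂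
  -- the potential term `X z = (λ/R²) Σ_{w ∈ S} G(z - w) ∈ [0, P/R²]`
  have hX : ∀ z : Site 3, 0 ≤ lam / R ^ 2 * ∑ w ∈ S, G (z - w) ∧
      lam / R ^ 2 * ∑ w ∈ S, G (z - w) ≤ P / R ^ 2 := fun z => by
    obtain ⟨hΞ0, hΞ⟩ := subProfile_potential_bounds hGpos hGle S z
    exact ⟨by positivity,
      (mul_le_mul_of_nonneg_left hΞ (by positivity)).trans_eq (div_mul_eq_mul_div _ _ _)⟩
  have hP1 : P / R ^ 2 ≤ 1 := by rw [div_le_one (by positivity)]; nlinarith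
  refine ⟨fun y => G y * (2 + -(1 / (4 * R ^ 2)) * ∑ j, ((y j : ℤ) : ℝ) ^ 2) +
    lam / R ^ 2 * ∑ w ∈ S, G (y - w), fun V hV => ⟨fun z hz hz3 => ?_, ?_⟩,
    fun z hz2 => ?_, fun z hz1 hz3 => ?_⟩
  · -- supersolution off the origin
    obtain ⟨hX0, hXP⟩ := hX z
    have hsr : ∑ j, ((z j : ℤ) : ℝ) ^ 2 = Real.sqrt (∑ j, ((z j : ℤ) : ℝ) ^ 2) ^ 2 :=
      (Real.sq_sqrt (Finset.sum_nonneg fun j _ => sq_nonneg _)).symm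
    have hr1 : 1 ≤ Real.sqrt (∑ j, ((z j : ℤ) : ℝ) ^ 2) := one_le_sqrt_sum_sq_of_ne_zero hz
    beta_reduce
    rw [superProfile_laplacian_profile hG0 hG1, hG0 z hz, mul_zero, zero_add, hsr]
    by_cases hzr : Real.sqrt (∑ j, ((z j : ℤ) : ℝ) ^ 2) < r₃
    · -- near sites `z ∈ F₀`
      rw [if_pos ((hS z).2 ⟨hz, hzr⟩), mul_one]
      exact superProfile_arith_near hB0 (by linarith) (Real.sqrt_nonneg _) hz3 hR1
        (hGpos z).le (hGle z) hX0 (hXP.trans hP1) (hV z hz3) hc₁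
        (subProfile_phi_lower hGpos hGle z hzr.le)
    · -- far sites `|z| ≥ r₃`
      replace hzr := not_lt.1 hzr
      rw [if_neg (fun h => (not_lt.2 hzr) ((hS z).1 h).2), mul_zero, sub_zero]
      have hX1 : lam / R ^ 2 * ∑ w ∈ S, G (z - w) ≤ 1 / Real.sqrt (∑ j, ((z j : ℤ) : ℝ) ^ 2) := by
        refine hXP.trans ?_
        rw [div_le_div_iff₀ (by positivity) (by linarith)]
        nlinarith [mul_le_mul_of_nonneg_left hz3 hP0]
      exact superProfile_arith_far ha hK hr1 hz3 hR1 (hGpos z).le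
        (by linarith [(abs_le.1 (hGasym z hz)).2]) hX0 hX1 (hV z hz3) hcM₁ (hmod z hzr).1
  · -- the origin
    obtain ⟨hX0, hXP⟩ := hX 0
    have h0S : (0 : Site 3) ∉ S := fun h => ((hS 0).1 h).1 rfl
    have hs0 : ∑ j, (((0 : Site 3) j : ℤ) : ℝ) ^ 2 = 0 := by simp
    have hΦ0 : ∑ i : Fin 3, (((0 : Site 3) i : ℤ) : ℝ) *
        (G (0 + Pi.single i 1) - G (0 - Pi.single i 1)) = 0 := by simp
    have hV0 : |V 0| ≤ c₁ / R ^ 2 := hV 0 (by rw [hs0, Real.sqrt_zero]; positivity)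
    have key := superProfile_arith_origin hR1 (hGpos 0).le (hGle 0) hX0 (hXP.trans hP1) hV0 hcM₂
    beta_reduce
    rw [superProfile_laplacian_profile hG0 hG1, if_neg h0S, hG1, hs0, hΦ0]
    calc _ = -(2 + -(1 / (4 * R ^ 2))) + -(1 / (4 * R ^ 2)) * (6 * G 0) := by ring
      _ ≤ V 0 * (G 0 * 2 + lam / R ^ 2 * ∑ w ∈ S, G (0 - w)) - 1 := key
      _ = _ := by ring
  · -- nonnegativity on `|z| ≤ 2R`
    have hsr : ∑ j, ((z j : ℤ) : ℝ) ^ 2 = Real.sqrt (∑ j, ((z j : ℤ) : ℝ) ^ 2) ^ 2 :=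
      (Real.sq_sqrt (Finset.sum_nonneg fun j _ => sq_nonneg _)).symm
    beta_reduce
    rw [hsr]
    exact superProfile_arith_nonneg hR0 (Real.sqrt_nonneg _) hz2 (hGpos z).le (hX z).1
  · -- upper size bound on `R/8 ≤ |z| ≤ 3R`
    obtain ⟨hX0, hXP⟩ := hX z
    have hr0 : 0 < Real.sqrt (∑ i, ((z i : ℤ) : ℝ) ^ 2) := (div_pos hR0 (by norm_num)).trans_le hz1
    have hg := hGasym z (greenMod_ne_zero_of_sumSq_pos z (Real.sqrt_pos.1 hr0))
    have hsr : ∑ j, ((z j : ℤ) : ℝ) ^ 2 = Real.sqrt (∑ j, ((z j : ℤ) : ℝ) ^ 2) ^ 2 :=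
      (Real.sq_sqrt (Finset.sum_nonneg fun j _ => sq_nonneg _)).symm
    have hXR : lam / R ^ 2 * (∑ w ∈ S, G (z - w)) * R ^ 2 ≤ P := (le_div_iff₀ (by positivity)).1 hXP
    beta_reduce
    generalize lam / R ^ 2 * ∑ w ∈ S, G (z - w) = X at hX0 hXR ⊢
    generalize Real.sqrt (∑ j, ((z j : ℤ) : ℝ) ^ 2) = r at hg hz1 hz3 hsr ⊢
    rw [hsr]
    exact superProfile_arith_size ha hR1 hz1 hz3 hg hRK hX0 hXR hRP'

end Summit.CriticalPhenomena.Ising3DConformalLimit.Theorems.PositiveSolutionAsymptotics
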